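import Mathlib
import Summits.ResolutionOfSingularities.ResolutionOfSingularities.Theorems.WildQuotientsWildQuotientResolutionJordanFourTwistedChartFixed
import Summits.ResolutionOfSingularities.ResolutionOfSingularities.Theorems.WildQuotientsWildQuotientResolutionJordanFourChart0Subring

/-!
# R-T rung (J₅) — invariants of the translation `Σ_l : ξ ↦ ξ + l` inside a weight-`0` part: the graded Artin–Schreier substitution

(crux stmt-ResolutionOfSingularities-15640 `WildQuotients.WildQuotientResolution`, line `Sketch`,
sector `|G| = p`; programme «R-T twisted root charts in general» of `L/w45c/CHAIN.md` v7.9 §5,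
`L/res-L1-w45c-idea-2/RT-J5.md` §4 («after the σ̃-quotient (ξ → N_ξ = ξ^p − l^{p−1}ξ, character p̄):
Y₁ = ⅓(1, 2, p̄, 2) × 𝔸¹»), res-L1-w45c-lead-1's RUNG V5 brick B3 ⇒ HP₁ (2026-08-27T10:22:53Z).
[OURS · L1 W4.5c] — NOT a statement of any manuscript (Hironaka 2017 is consumed nowhere); replaces
the role of no printed item. Prover res-L1-w45c-stub-1. AI-written Lean, kernel-checked; weaker than
expert review.)

The `μ₃`-vertex piece of `Bl_w 𝔸ⁿ / σ` for `J₅` is computed in three moves: (T5-ii) the chart ring of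
the piece is the `μ₃`-weight-`0` part of `k[l, A, ξ, η₁, η₂, passengers]` (weight `w(l,A,ξ,η₁,η₂) =
(1,2,1,2,0)`, `…JordanFiveTwistedChartCubic`); (T5-i) on it `σ` is the translation `Σ_l : ξ ↦ ξ + l`;
(this file) the `Σ_l`-invariants of a weight-`0` part are the weight-`0` part of
`k[l, A, N, η₁, η₂, passengers]`, `N = ξ^p − l^{p−1}ξ` of weight `p·w(ξ) = p̄`, i.e. the coordinate ring
of the cyclic quotient cone `⅓(1, 2, p̄, 2) × 𝔸` — before localising at `Q`.

* `translate_fixedPoints_inter_weightZero_eq` — GENERIC GRADED FORM (any finite weight monoid `M`,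
  any `w : Fin n → M` with `w b = w c`, prime characteristic `p`): for ANY `k`-algebra endomorphism
  `τ` with `τ (X c) = X c + X b`, `τ (X i) = X i` (`i ≠ c`), and any subalgebra `R` that is the
  weight-`0` part of the weight `w₁ := w` except `w₁ c := p • w c`,
  `{f | IsWeightedHomogeneous w f 0 ∧ τ f = f} = θ(R)` for the Artin–Schreier slot substitution
  `θ : X c ↦ X c^p − X b^{p−1} X c`, `X i ↦ X i`.
  Route (as V3U-C2 / B0-b `JordanFour.chart0_fixedPoints_eq_map`): a fixed `f` is `θ P`
  (`JordanFour.translate_fixedPoints_eq`, no correction terms); `θ` carries `w₁` to `w`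
  (`JordanFour.weightedHomogeneousComponent_aeval`), so a weight-`0` `f` is `θ` of the weight-`0`
  part of `P`. No algebraic independence is used; `R` is left abstract so that res-L1-w45c-stub-2's
  THEOREM T3 presentation of the `⅓(1^a, 2^b) × 𝔸^c` cones plugs in by its range (as B0-a did).
* `translate_fixedPoints_inter_cubic_eq` — the J₅ instance: `w(b, a, c, d) = (1, 2, 1, 2)`, `0`
  elsewhere (`ZMod 3`), `w₁ c = p`.
-/

-- single-problem summit: the doubled namespace component `ResolutionOfSingularities` is forced
set_option linter.dupNamespace false

noncomputable section

open MvPolynomial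

namespace Summit.ResolutionOfSingularities.ResolutionOfSingularities.Theorems.WildQuotientResolution.JordanFive

section Generic

variable (k : Type) [Field k] (n : ℕ) (b c : Fin n) (hbc : b ≠ c)
  (τ : MvPolynomial (Fin n) k →ₐ[k] MvPolynomial (Fin n) k)
  (hτc : τ (X c) = X c + X b) (hτ : ∀ i, i ≠ c → τ (X i) = X i)

include hbc hτc hτ in
/-- **Invariants of the translation `ξ ↦ ξ + l` inside a weight-`0` part = the Artin–Schreier
substitution of a weight-`0` part.** Generic graded form: `M` a finite additive monoid,
`w : Fin n → M` with `w b = w c`, `w₁` equal to `w` off `c` and `w₁ c = p • w c`, `R` the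
`w₁`-weight-`0` subalgebra; then `{f | IsWeightedHomogeneous w f 0 ∧ τ f = f} = θ(R)`,
`θ : X c ↦ X c^p − X b^{p−1}X c`, `X i ↦ X i`. [OURS · L1 W4.5c] -/
theorem translate_fixedPoints_inter_weightZero_eq (p : ℕ) (hp : p.Prime) [CharP k p]
    {M : Type*} [AddCommMonoid M] [Fintype M] [DecidableEq M]
    (w : Fin n → M) (hwbc : w b = w c) (w₁ : Fin n → M) (hw₁c : w₁ c = p • w c)
    (hw₁ : ∀ i, i ≠ c → w₁ i = w i)
    (R : Subalgebra k (MvPolynomial (Fin n) k)) (hR : ∀ P, P ∈ R ↔ IsWeightedHomogeneous w₁ P 0) :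
    {f : MvPolynomial (Fin n) k | IsWeightedHomogeneous w f 0 ∧ τ f = f} =
      (R.map (aeval (fun i : Fin n => if i = c then X c ^ p - X b ^ (p - 1) * X c
          else (X i : MvPolynomial (Fin n) k)) :
          MvPolynomial (Fin n) k →ₐ[k] MvPolynomial (Fin n) k) : Set (MvPolynomial (Fin n) k)) := by
  classical
  have hp1 : p - 1 + 1 = p := Nat.sub_add_cancel hp.one_lt.le
  -- the Artin–Schreier element and the slot substitution `θ = aeval g`
  set N : MvPolynomial (Fin n) k := X c ^ p - X b ^ (p - 1) * X c with hN
  let g : Fin n → MvPolynomial (Fin n) k := fun i => if i = c then N else X i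
  have hgc : g c = N := if_pos rfl
  have hgi : ∀ i, i ≠ c → g i = X i := fun i hic => if_neg hic
  -- weights: `θ` carries `w₁` to `w`
  have hNw : IsWeightedHomogeneous w N (p • w c) := by
    have h1 : IsWeightedHomogeneous w (X c ^ p : MvPolynomial (Fin n) k) (p • w c) :=
      (isWeightedHomogeneous_X k w c).pow p
    have h2 : IsWeightedHomogeneous w (X b ^ (p - 1) * X c : MvPolynomial (Fin n) k) (p • w c) := by
      have h := ((isWeightedHomogeneous_X k w b).pow (p - 1)).mul (isWeightedHomogeneous_X k w c)
      rw [hwbc, ← succ_nsmul, hp1] at h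
      exact h
    exact (weightedHomogeneousSubmodule k w _).sub_mem h1 h2
  have hgw : ∀ i, IsWeightedHomogeneous w (g i) (w₁ i) := by
    intro i
    by_cases hic : i = c
    · subst hic
      rw [hgc, hw₁c]
      exact hNw
    · rw [hgi i hic, hw₁ i hic]
      exact isWeightedHomogeneous_X k w i
  -- `τ` fixes every `g i`, hence `θ(P)` for all `P`
  have hτN : τ N = N := JordanFour.translate_artinSchreier k n b c hbc τ hτc hτ p hp
  have hτg : ∀ i, τ (g i) = g i := by
    intro i
    by_cases hic : i = c
    · subst hic; rw [hgc, hτN]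
    · rw [hgi i hic, hτ i hic]
  have hτθ : ∀ P : MvPolynomial (Fin n) k,
      τ ((aeval g : MvPolynomial (Fin n) k →ₐ[k] MvPolynomial (Fin n) k) P) =
        (aeval g : MvPolynomial (Fin n) k →ₐ[k] MvPolynomial (Fin n) k) P := by
    intro P
    have key : τ.comp (aeval g) = aeval g := by
      refine MvPolynomial.algHom_ext fun i => ?_
      change τ (aeval g (X i)) = aeval g (X i)
      rw [aeval_X, hτg]
    exact congrArg (fun φ : MvPolynomial (Fin n) k →ₐ[k] MvPolynomial (Fin n) k => φ P) key
  -- `k[N, X i (i ≠ c)] ≤ range θ`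
  have hFle : Algebra.adjoin k (({X c ^ p - X b ^ (p - 1) * X c} : Set (MvPolynomial (Fin n) k)) ∪
      ((fun i => X i) '' {i | i ≠ c})) ≤
        (aeval g : MvPolynomial (Fin n) k →ₐ[k] MvPolynomial (Fin n) k).range := by
    refine Algebra.adjoin_le ?_
    rintro x hx
    rcases hx with hx | ⟨i, hic, rfl⟩
    · rw [Set.mem_singleton_iff] at hx
      subst hx
      exact (AlgHom.mem_range _).mpr ⟨X c, by rw [aeval_X, hgc]⟩
    · exact (AlgHom.mem_range _).mpr ⟨X i, by rw [aeval_X, hgi i hic]⟩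
  apply Set.Subset.antisymm
  · -- `⊆`: a fixed weight-`0` `f` is `θ` of the weight-`0` part of a preimage
    rintro f ⟨hf0, hfτ⟩
    have hfF : f ∈ (Algebra.adjoin k (({X c ^ p - X b ^ (p - 1) * X c} :
        Set (MvPolynomial (Fin n) k)) ∪ ((fun i => X i) '' {i | i ≠ c})) :
        Set (MvPolynomial (Fin n) k)) := by
      rw [← JordanFour.translate_fixedPoints_eq k n b c hbc τ hτc hτ p hp]
      exact hfτ
    obtain ⟨P, hP⟩ := (AlgHom.mem_range _).mp (hFle hfF)
    have hcomp : f = aeval g (weightedHomogeneousComponent w₁ 0 P) := by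
      rw [← JordanFour.weightedHomogeneousComponent_aeval w₁ w g hgw P 0, hP]
      exact (hf0.weightedHomogeneousComponent_same).symm
    rw [hcomp]
    exact Subalgebra.mem_map.mpr
      ⟨_, (hR _).mpr (weightedHomogeneousComponent_isWeightedHomogeneous 0 P), rfl⟩
  · -- `⊇`: `θ(R)` is weight-`0` and fixed
    rintro f hf
    obtain ⟨P, hPR, rfl⟩ := Subalgebra.mem_map.mp hf
    exact ⟨ToricExit.isWeightedHomogeneous_aeval w₁ w g hgw P 0 ((hR P).mp hPR), hτθ P⟩

end Generic

section JordanFive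

variable (k : Type) [Field k] (n : ℕ) (a b c d : Fin n) (hbc : b ≠ c)
  (τ : MvPolynomial (Fin n) k →ₐ[k] MvPolynomial (Fin n) k)
  (hτc : τ (X c) = X c + X b) (hτ : ∀ i, i ≠ c → τ (X i) = X i)

include hbc hτc hτ in
/-- **J₅ instance: `Σ_l`-invariants of the `μ₃`-weight-`0` part = the `⅓(1,2,p̄,2) × 𝔸` cone algebra
(through the Artin–Schreier substitution).** Weights `w(b, a, c, d) = (1, 2, 1, 2)`, `0` elsewhere;
`w₁ = w` except `w₁ c = p`; `R` = the `w₁`-weight-`0` subalgebra (any presentation of it).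
[OURS · L1 W4.5c] -/
theorem translate_fixedPoints_inter_cubic_eq (p : ℕ) (hp : p.Prime) [CharP k p]
    (w : Fin n → ZMod 3) (hwa : w a = 2) (hwb : w b = 1) (hwc : w c = 1) (hwd : w d = 2)
    (hw0 : ∀ i, i ≠ a → i ≠ b → i ≠ c → i ≠ d → w i = 0)
    (w₁ : Fin n → ZMod 3) (hw₁a : w₁ a = 2) (hw₁b : w₁ b = 1) (hw₁c : w₁ c = (p : ZMod 3))
    (hw₁d : w₁ d = 2) (hw₁0 : ∀ i, i ≠ a → i ≠ b → i ≠ c → i ≠ d → w₁ i = 0)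
    (R : Subalgebra k (MvPolynomial (Fin n) k)) (hR : ∀ P, P ∈ R ↔ IsWeightedHomogeneous w₁ P 0) :
    {f : MvPolynomial (Fin n) k | IsWeightedHomogeneous w f 0 ∧ τ f = f} =
      (R.map (aeval (fun i : Fin n => if i = c then X c ^ p - X b ^ (p - 1) * X c
          else (X i : MvPolynomial (Fin n) k)) :
          MvPolynomial (Fin n) k →ₐ[k] MvPolynomial (Fin n) k) : Set (MvPolynomial (Fin n) k)) := by
  refine translate_fixedPoints_inter_weightZero_eq k n b c hbc τ hτc hτ p hp w (by rw [hwb, hwc]) w₁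
    (by rw [hw₁c, hwc, nsmul_eq_mul, mul_one]) (fun i hic => ?_) R hR
  by_cases hia : i = a
  · subst hia; rw [hw₁a, hwa]
  by_cases hib : i = b
  · subst hib; rw [hw₁b, hwb]
  by_cases hid : i = d
  · subst hid; rw [hw₁d, hwd]
  rw [hw₁0 i hia hib hic hid, hw0 i hia hib hic hid]

end JordanFive

end Summit.ResolutionOfSingularities.ResolutionOfSingularities.Theorems.WildQuotientResolution.JordanFive

end
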